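import Literature.NumberTheory.LFunctions.ZetaSubconvexity
import Literature.NumberTheory.LFunctions.RiemannSiegelPhase
import HarnessLib

/-!
# `χ(1/2 + it) = e^{-2iϑ(t)}`

Topic `Literature/NumberTheory/LFunctions`. Everything in this file is PROVED (no definitions, no
named facts).

Titchmarsh's factor `χ(s) = 2^s π^{s-1} sin(πs/2) Γ(1-s)` of the functional equation
`ζ(s) = χ(s) ζ(1-s)` (tree: `Literature.NumberTheory.LFunctions.riemannZetaChi`) equals
`π^{s-1/2} Γ((1-s)/2)/Γ(s/2)` (Legendre's duplication formula and the reflection formula), and on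
the critical line this is `e^{-2iϑ(t)}` for the Riemann–Siegel theta function
`e^{iϑ(t)} = π^{-it/2} Γ(1/4 + it/2)/|Γ(1/4 + it/2)|`
(tree: `Literature.NumberTheory.LFunctions.cexp_riemannSiegelTheta_mul_I_holds`). This is Titchmarsh's
"`e^{iϑ} = {χ(1/2+it)}^{-1/2}`" (§4.17), the identity behind `Z(t) = e^{iϑ(t)} ζ(1/2+it) ∈ ℝ` and
`Z(t) = z(t) + z̄(t) + O(t^{-1/4})` (§9.20).

* `Literature.NumberTheory.LFunctions.riemannZetaChi_half_eq_Gamma_div` —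
  `χ(1/2+it) = π^{it} Γ(1/4 − it/2)/Γ(1/4 + it/2)`;
* `Literature.NumberTheory.LFunctions.riemannZetaChi_half_mul_cexp_two_theta` —
  `χ(1/2+it) e^{2iϑ(t)} = 1`;
* `Literature.NumberTheory.LFunctions.riemannZetaChi_half_eq_cexp` — `χ(1/2+it) = e^{-2iϑ(t)}`;
* `Literature.NumberTheory.LFunctions.cexp_theta_mul_riemannZetaChi_half` — `e^{iϑ} χ(1/2+it) = e^{-iϑ}`.

## References

* E. C. Titchmarsh, *The Theory of the Riemann Zeta-Function*, 2nd ed. (1986), §2.1 eq. (2.1.10),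
  §4.17 eq. (4.17.2)–(4.17.3). [cite: Titchmarsh1986, §4.17]
-/

noncomputable section

open Real Complex
open scoped ComplexConjugate

namespace Literature.NumberTheory.LFunctions

/-- `sin(π(1/4 + it/2)) ≠ 0`. [folklore] -/
theorem sin_pi_mul_quarter_add_ne_zero (t : ℝ) : Complex.sin (π * (1 / 4 + t / 2 * I)) ≠ 0 := by
  intro h
  obtain ⟨k, hk⟩ := Complex.sin_eq_zero_iff.1 h
  have hπ : (π : ℂ) ≠ 0 := by exact_mod_cast Real.pi_pos.ne'
  have hw : (1 / 4 + t / 2 * I : ℂ) = k := by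
    rw [mul_comm] at hk
    exact mul_right_cancel₀ hπ hk
  have hre := congrArg Complex.re hw
  simp at hre
  -- `1/4 = k` with `k : ℤ` is impossible
  have h4 : (4 : ℝ) * k = 1 := by rw [← hre]; norm_num
  have h4' : (4 : ℤ) * k = 1 := by exact_mod_cast h4
  omega

/-- `√π = π^{1/2}` in `ℂ`. [folklore] -/
theorem ofReal_sqrt_pi_eq_cpow : ((Real.sqrt π : ℝ) : ℂ) = (π : ℂ) ^ ((1 / 2 : ℂ)) := by
  rw [Real.sqrt_eq_rpow, Complex.ofReal_cpow Real.pi_pos.le]; push_cast; rfl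

/-- **`χ(1/2+it) = π^{it} Γ(1/4 − it/2)/Γ(1/4 + it/2)`** (duplication + reflection).
[cite: Titchmarsh1986, §4.17] -/
theorem riemannZetaChi_half_eq_Gamma_div (t : ℝ) :
    riemannZetaChi (1 / 2 + t * I) =
      (π : ℂ) ^ ((t : ℂ) * I) * Complex.Gamma (1 / 4 - t / 2 * I) / Complex.Gamma (1 / 4 + t / 2 * I) := by
  set s : ℂ := 1 / 2 + t * I with hs
  set w : ℂ := 1 / 4 + t / 2 * I with hw
  set z : ℂ := 1 / 4 - t / 2 * I with hz
  have hπ0 : (π : ℂ) ≠ 0 := by exact_mod_cast Real.pi_pos.ne'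
  have h2 : (2 : ℂ) ≠ 0 := two_ne_zero
  have hΓw : Complex.Gamma w ≠ 0 := Complex.Gamma_ne_zero_of_re_pos (by simp [hw])
  have hsin : Complex.sin (π * w) ≠ 0 := by rw [hw]; exact sin_pi_mul_quarter_add_ne_zero t
  have hsqrtπ : ((Real.sqrt π : ℝ) : ℂ) ≠ 0 := by
    exact_mod_cast (Real.sqrt_pos.2 Real.pi_pos).ne'
  have h2s : (2 : ℂ) ^ s ≠ 0 := Complex.cpow_ne_zero_iff.2 (Or.inl h2)
  -- Legendre at `z`: `Γ(z) Γ(z + 1/2) = Γ(2z) 2^{1−2z} √π`, `2z = 1 − s`, `z + 1/2 = 1 − w`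
  have hleg := Complex.Gamma_mul_Gamma_add_half z
  have h2z : 2 * z = 1 - s := by rw [hz, hs]; ring
  have hz12 : z + 1 / 2 = 1 - w := by rw [hz, hw]; ring
  have hpow2 : (2 : ℂ) ^ (1 - (1 - s)) = 2 ^ s := by ring_nf
  rw [h2z, hz12, hpow2] at hleg
  -- reflection at `w`: `Γ(w) Γ(1−w) = π / sin(πw)`, `πs/2 = πw`
  have hrefl := Complex.Gamma_mul_Gamma_one_sub w
  have hπw : (π : ℂ) * s / 2 = π * w := by rw [hs, hw]; ring
  have hG1w : Complex.Gamma (1 - w) = π / (Complex.sin (π * w) * Complex.Gamma w) := by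
    rw [eq_div_iff (mul_ne_zero hsin hΓw)]
    have h := hrefl
    rw [eq_div_iff hsin] at h
    linear_combination h
  have hG1s : Complex.Gamma (1 - s) =
      Complex.Gamma z * Complex.Gamma (1 - w) / (2 ^ s * (Real.sqrt π : ℂ)) := by
    rw [eq_div_iff (mul_ne_zero h2s hsqrtπ)]
    linear_combination -hleg
  -- the powers of `π`: `π^{s−1} · π / √π = π^{it}`
  have hπpow : (π : ℂ) ^ (s - 1) * π / (Real.sqrt π : ℂ) = (π : ℂ) ^ ((t : ℂ) * I) := by
    rw [ofReal_sqrt_pi_eq_cpow, div_eq_iff (Complex.cpow_ne_zero_iff.2 (Or.inl hπ0)),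
      ← Complex.cpow_add _ _ hπ0]
    nth_rewrite 2 [← Complex.cpow_one (π : ℂ)]
    rw [← Complex.cpow_add _ _ hπ0]
    congr 1
    rw [hs]; ring
  rw [riemannZetaChi_def, hπw, hG1s, hG1w]
  rw [← hπpow]
  field_simp

/-- **`χ(1/2+it) e^{2iϑ(t)} = 1`** for the Riemann–Siegel theta function of the tree.
[cite: Titchmarsh1986, §4.17 eq. (4.17.2)] -/
theorem riemannZetaChi_half_mul_cexp_two_theta (t : ℝ) :
    riemannZetaChi (1 / 2 + t * I) * cexp (2 * (riemannSiegelTheta t : ℂ) * I) = 1 := by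
  have hE := cexp_riemannSiegelTheta_mul_I_holds t
  set w : ℂ := 1 / 4 + t / 2 * I with hw
  have hπ0 : (π : ℂ) ≠ 0 := by exact_mod_cast Real.pi_pos.ne'
  have hΓw : Complex.Gamma w ≠ 0 := Complex.Gamma_ne_zero_of_re_pos (by simp [hw])
  have hnorm : ((‖Complex.Gamma w‖ : ℝ) : ℂ) ≠ 0 := by
    exact_mod_cast (norm_pos_iff.2 hΓw).ne'
  have hsq : cexp (2 * (riemannSiegelTheta t : ℂ) * I) =
      cexp (riemannSiegelTheta t * I) * cexp (riemannSiegelTheta t * I) := by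
    rw [← Complex.exp_add]; ring_nf
  have hz : (1 / 4 - t / 2 * I : ℂ) = conj w := by
    simp only [hw, map_add, map_div₀, map_mul, Complex.conj_ofReal, Complex.conj_I, map_one,
      map_ofNat]
    ring
  rw [hsq, hE, riemannZetaChi_half_eq_Gamma_div, hz, Complex.Gamma_conj,
    show (1 / 4 + t / 2 * I : ℂ) = w from rfl]
  -- `π^{it} conj(Γw)/Γw · (π^{-it/2} Γw/‖Γw‖)² = conj(Γw) Γw/‖Γw‖² = 1`
  have hππ : (π : ℂ) ^ ((t : ℂ) * I) * ((π : ℂ) ^ (-(t : ℂ) * I / 2) * (π : ℂ) ^ (-(t : ℂ) * I / 2)) = 1 := by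
    rw [← Complex.cpow_add _ _ hπ0, ← Complex.cpow_add _ _ hπ0]
    ring_nf
    exact Complex.cpow_zero _
  have hcn : conj (Complex.Gamma w) * Complex.Gamma w = ((‖Complex.Gamma w‖ : ℝ) : ℂ) ^ 2 := by
    rw [mul_comm, Complex.mul_conj, Complex.normSq_eq_norm_sq]; push_cast; ring
  calc (π : ℂ) ^ ((t : ℂ) * I) * conj (Complex.Gamma w) / Complex.Gamma w *
        ((π : ℂ) ^ (-(t : ℂ) * I / 2) * Complex.Gamma w / ((‖Complex.Gamma w‖ : ℝ) : ℂ) *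
          ((π : ℂ) ^ (-(t : ℂ) * I / 2) * Complex.Gamma w / ((‖Complex.Gamma w‖ : ℝ) : ℂ)))
      = ((π : ℂ) ^ ((t : ℂ) * I) * ((π : ℂ) ^ (-(t : ℂ) * I / 2) * (π : ℂ) ^ (-(t : ℂ) * I / 2)))
          * (conj (Complex.Gamma w) * Complex.Gamma w) * (Complex.Gamma w / Complex.Gamma w)
          / ((‖Complex.Gamma w‖ : ℝ) : ℂ) ^ 2 := by ring
    _ = 1 := by
        rw [hππ, hcn, div_self hΓw, one_mul, mul_one, div_self (pow_ne_zero 2 hnorm)]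

/-- **`χ(1/2+it) = e^{-2iϑ(t)}`**. [cite: Titchmarsh1986, §4.17 eq. (4.17.2)] -/
theorem riemannZetaChi_half_eq_cexp (t : ℝ) :
    riemannZetaChi (1 / 2 + t * I) = cexp (-(2 * (riemannSiegelTheta t : ℂ) * I)) := by
  have h := riemannZetaChi_half_mul_cexp_two_theta t
  rw [Complex.exp_neg]
  exact (inv_eq_of_mul_eq_one_left h).symm

/-- **`e^{iϑ(t)} χ(1/2+it) = e^{-iϑ(t)}`** (Titchmarsh: "`e^{iϑ} = {χ(1/2+it)}^{-1/2}`").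
[cite: Titchmarsh1986, §4.17 eq. (4.17.2)] -/
theorem cexp_theta_mul_riemannZetaChi_half (t : ℝ) :
    cexp (riemannSiegelTheta t * I) * riemannZetaChi (1 / 2 + t * I) =
      cexp (-(riemannSiegelTheta t * I)) := by
  rw [riemannZetaChi_half_eq_cexp, ← Complex.exp_add]
  congr 1; ring

end Literature.NumberTheory.LFunctions
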